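import Summits.HubbardSuperconductivity.HubbardSuperconductivity.Theorems.AnisotropyChordTransferFibre3RowCShellWinLemmas
import Summits.HubbardSuperconductivity.HubbardSuperconductivity.Theorems.AnisotropyChordTransferFibre3ManifoldA64

/-!
# Route `AnisotropyChord` / H0 rotor rung, row C (KT-2b) on the t-BLOCKS: the THIRD-SHELL WINDOW and the AXIS VALUE for `L ≥ 64`

Block versions (`L ≥ 64`; V ≥ 4096, `ln x/x² ≤ 4.1589/4096`, family A of `…ManifoldA64`) of two row-C window numerics stated for
`L ≥ 128` in `…RowCWindow3` / `…RowCShellWinLemmas` (inventory memo HOME/hubbard-h0-rotor-p2/TBLOCK-INVENTORY-g8.md, items 5/13):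
* ★ `third_shell_window64`: for `L ≥ 64`, `0 ≤ ν ≤ 0.0513`, `λ = ν(2π/L)²`:
  `|a_λ(2,1) − (2/π − 1/4)| ≤ 0.0031`,  `|a_λ(3,0) − (17/4 − 12/π)| ≤ 0.01`  (λ-parts `≤ 5ν·0.0087`, `≤ 9ν·0.0087`; `λ = 0`
  deviations `≤ 3/4096`, `≤ 24/4096` — the latter dominates the `(3,0)` tolerance);
* ★ `window_k10_64`: `a_λ(1,0) ∈ [0.24993, 0.25]` for the ground profile, `L ≥ 64` (`manifold_band64`).
Same proofs as the `L ≥ 128` lemmas.  (`second_shell_window64`: `…ManifoldA64`.)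
Prover seat `hubbard-h0-rotor-p2` g8; helper for piece A = stmt-HubbardSuperconductivity-23918 of rung 19089
(`--supports`, helper class).  WHAT THIS IS NOT: nothing here proves superconductivity in the Hubbard model; window enclosures for
ONE row of ONE conditional reduction on the t-blocks; the rotor TARGET as originally worded stays FALSE (g15 verdict).
Tree imports only; no new definitions; no sorry.
-/

set_option linter.dupNamespace false
set_option autoImplicit false

noncomputable section

namespace Summit.HubbardSuperconductivity.HubbardSuperconductivity.Theorems.AnisotropyChord.Transfer.Fibre3

namespace RowC

variable (L : ℕ) [NeZero L]

/-- ★ THIRD-SHELL WINDOW at `L ≥ 64`: for `0 ≤ ν ≤ 0.0513`, `λ = ν(2π/L)²`: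
`|a_λ(2,1) − (2/π − 1/4)| ≤ 0.0031` and `|a_λ(3,0) − (17/4 − 12/π)| ≤ 0.01`. [folklore] -/
theorem third_shell_window64 (hL : 64 ≤ L) (ν : ℝ) (hν0 : 0 ≤ ν) (hν : ν ≤ 0.0513) :
    |aKer L (ν * (2 * Real.pi / L) ^ 2) ((((2 : ℤ)) : ZMod L), (((1 : ℤ)) : ZMod L)) - (2 / Real.pi - 1 / 4)| ≤ 0.0031 ∧
    |aKer L (ν * (2 * Real.pi / L) ^ 2) ((((3 : ℤ)) : ZMod L), (((0 : ℤ)) : ZMod L)) - (17 / 4 - 12 / Real.pi)| ≤ 0.01 := by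
  have hL0 : (0 : ℝ) < L := by exact_mod_cast (show 0 < L by omega)
  have hL64 : (64 : ℝ) ≤ L := by exact_mod_cast hL
  have hV : (0 : ℝ) < (L : ℝ) ^ 2 := by positivity
  have hν7 : ν ≤ 0.07 := by linarith
  have hlogq := ManifoldA.log_div_sq_le64 (L : ℝ) hL64
  have hinv : 1 / (L : ℝ) ^ 2 ≤ 1 / 4096 := one_div_le_one_div_of_le (by norm_num) (by nlinarith)
  have hlog0 : 0 ≤ Real.log L := Real.log_nonneg (by linarith)
  -- λ-parts
  have hl21 := CapacityConst.lamPart_KT_le L (by omega) ν hν0 hν7 2 1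
  have hl30 := CapacityConst.lamPart_KT_le L (by omega) ν hν0 hν7 3 0
  have hε : 0 < eps1 L := RateLemma.eps1_pos_of_two_le L (by omega)
  have hπlo := Real.pi_gt_d6
  have hπhi := Real.pi_lt_d6
  have hlam0 : 0 ≤ ν * (2 * Real.pi / L) ^ 2 := by positivity
  have hlam1 : ν * (2 * Real.pi / L) ^ 2 < 2 * eps1 L := by
    have hεJ : 2 / Real.pi ^ 2 * (2 * Real.pi / L) ^ 2 ≤ eps1 L := RateLemma.eps1_ge_jordan L (by omega)
    have h1 : ν * (2 * Real.pi / L) ^ 2 < 4 / Real.pi ^ 2 * (2 * Real.pi / L) ^ 2 := by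
      apply mul_lt_mul_of_pos_right _ (by positivity)
      rw [lt_div_iff₀ (by positivity)]; nlinarith
    have h2 : 4 / Real.pi ^ 2 * (2 * Real.pi / L) ^ 2 = 2 * (2 / Real.pi ^ 2 * (2 * Real.pi / L) ^ 2) := by ring
    linarith
  have hp21 := (RateLemma.lamPartShellBound_holds L (by omega) _ hlam0 hlam1 ((((2 : ℤ)) : ZMod L), (((1 : ℤ)) : ZMod L))).1
  have hp30 := (RateLemma.lamPartShellBound_holds L (by omega) _ hlam0 hlam1 ((((3 : ℤ)) : ZMod L), (((0 : ℤ)) : ZMod L))).1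
  -- λ = 0 deviations
  have hd21 := Subsample.dev_two_one L (by omega)
  have hd30 := Subsample.dev_three_zero L (by omega)
  rw [Subsample.aZ2_two_one'] at hd21
  rw [Subsample.aZ2_three_zero'] at hd30
  obtain ⟨hd21a, hd21b⟩ := abs_le.mp hd21
  obtain ⟨hd30a, hd30b⟩ := abs_le.mp hd30
  -- numeric sizes
  have hsz : (7.76 * Real.log L + 3.3) / (L : ℝ) ^ 2 ≤ 0.0087 := by
    have e : (7.76 * Real.log L + 3.3) / (L : ℝ) ^ 2 = 7.76 * (Real.log L / (L : ℝ) ^ 2) + 3.3 * (1 / (L : ℝ) ^ 2) := by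
      field_simp
    rw [e]; nlinarith
  have hl21' : RateLemma.lamPart L (ν * (2 * Real.pi / L) ^ 2) ((((2 : ℤ)) : ZMod L), (((1 : ℤ)) : ZMod L)) ≤ 0.0023 := by
    refine hl21.trans ?_
    push_cast
    have e : ν * ((2 : ℝ) ^ 2 + (1 : ℝ) ^ 2) * (7.76 * Real.log L + 3.3) / (L : ℝ) ^ 2
        = 5 * ν * ((7.76 * Real.log L + 3.3) / (L : ℝ) ^ 2) := by ring
    rw [e]
    have h0 : 0 ≤ (7.76 * Real.log L + 3.3) / (L : ℝ) ^ 2 := by positivity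
    have := mul_le_mul hν hsz h0 (by norm_num)
    linarith
  have hl30' : RateLemma.lamPart L (ν * (2 * Real.pi / L) ^ 2) ((((3 : ℤ)) : ZMod L), (((0 : ℤ)) : ZMod L)) ≤ 0.0041 := by
    refine hl30.trans ?_
    push_cast
    have e : ν * ((3 : ℝ) ^ 2 + (0 : ℝ) ^ 2) * (7.76 * Real.log L + 3.3) / (L : ℝ) ^ 2
        = 9 * ν * ((7.76 * Real.log L + 3.3) / (L : ℝ) ^ 2) := by ring
    rw [e]
    have h0 : 0 ≤ (7.76 * Real.log L + 3.3) / (L : ℝ) ^ 2 := by positivity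
    have := mul_le_mul hν hsz h0 (by norm_num)
    linarith
  have e21 : aKer L (ν * (2 * Real.pi / L) ^ 2) ((((2 : ℤ)) : ZMod L), (((1 : ℤ)) : ZMod L))
      = aKer L 0 ((((2 : ℤ)) : ZMod L), (((1 : ℤ)) : ZMod L))
        + RateLemma.lamPart L (ν * (2 * Real.pi / L) ^ 2) ((((2 : ℤ)) : ZMod L), (((1 : ℤ)) : ZMod L)) := by
    unfold RateLemma.lamPart; ring
  have e30 : aKer L (ν * (2 * Real.pi / L) ^ 2) ((((3 : ℤ)) : ZMod L), (((0 : ℤ)) : ZMod L))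
      = aKer L 0 ((((3 : ℤ)) : ZMod L), (((0 : ℤ)) : ZMod L))
        + RateLemma.lamPart L (ν * (2 * Real.pi / L) ^ 2) ((((3 : ℤ)) : ZMod L), (((0 : ℤ)) : ZMod L)) := by
    unfold RateLemma.lamPart; ring
  have h3 : 3 / (L : ℝ) ^ 2 ≤ 3 / 4096 := by
    apply div_le_div_of_nonneg_left (by norm_num) (by norm_num) (by nlinarith)
  have h24 : 24 / (L : ℝ) ^ 2 ≤ 24 / 4096 := by
    apply div_le_div_of_nonneg_left (by norm_num) (by norm_num) (by nlinarith)
  constructor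
  · rw [e21, abs_le]; constructor <;> linarith only [hd21a, hd21b, hp21, hl21', h3]
  · rw [e30, abs_le]; constructor <;> linarith only [hd30a, hd30b, hp30, hl30', h24]

/-- ★ the axis value `a_λ(1,0) = (1 − 1/V + (1 − a + a/V)/(V + a))/4 ∈ [0.24993, 0.25]` for the ground profile at `L ≥ 64`
(`V ≥ 4096`, `0 ≤ a`, `a(1 − 1/V) < 1` from `manifold_band64`). [folklore] -/
theorem window_k10_64 (hL : 64 ≤ L) {Δ lam2 : ℝ} {f : Tor L → ℝ} (hΔ0 : 0 ≤ Δ) (hΔ1 : Δ < 1)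
    (hf : IsGroundTwoMagnon L Δ lam2 f) :
    0.24993 ≤ aKer L lam2 (B1.toTor L ((1 : ℤ), (0 : ℤ))) ∧ aKer L lam2 (B1.toTor L ((1 : ℤ), (0 : ℤ))) ≤ 0.25 := by
  have hL5 : 5 ≤ L := by omega
  have hLpos : (0 : ℝ) < L := by exact_mod_cast (show 0 < L by omega)
  have hL64 : (64 : ℝ) ≤ L := by exact_mod_cast hL
  obtain ⟨hax, _⟩ := ManifoldA.axis_window_closed L hL5 hΔ0 hΔ1 hf
  obtain ⟨ha0, haV, _⟩ := ManifoldA.manifold_band64 L hL hΔ0 hΔ1 hf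
  rw [(ex_ey_toTor L).1, hax (ex L) (ex_mem_nnList L)]
  set a : ℝ := Δ * f (K1 L) with ha
  set V : ℝ := (L : ℝ) ^ 2 with hV
  have hV0 : (4096 : ℝ) ≤ V := by rw [hV]; nlinarith
  have hVpos : 0 < V := by linarith
  have hVa : 0 < V + a := by linarith
  have hnum : 0 ≤ 1 - a + a / V := by
    have : a * (1 - 1 / V) < 1 := haV
    have e : 1 - a + a / V = 1 - a * (1 - 1 / V) := by ring
    rw [e]; linarith
  have hfrac0 : 0 ≤ (1 - a + a / V) / (V + a) := div_nonneg hnum hVa.le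
  have hfrac1 : (1 - a + a / V) / (V + a) ≤ 1 / V := by
    rw [div_le_div_iff₀ hVa hVpos]
    have e : (1 - a + a / V) * V = V - a * V + a := by field_simp
    rw [e]; nlinarith
  have hinv : 1 / V ≤ 1 / 4096 := one_div_le_one_div_of_le (by norm_num) hV0
  constructor
  · linarith
  · linarith

end RowC

end Summit.HubbardSuperconductivity.HubbardSuperconductivity.Theorems.AnisotropyChord.Transfer.Fibre3

end
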